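import Literature.AlgebraicGeometry.Resolution.KollarSurfaceOrderReductionTameHypersurfacePart
import Literature.AlgebraicGeometry.Resolution.NormalCrossingsLocal
import Literature.AlgebraicGeometry.Resolution.OrderSemicontinuity
import HarnessLib

/-!
# Order reduction for marked ideals on surfaces in the tame regime `ord < p`: the global theorem

Topic: `Literature/AlgebraicGeometry/Resolution`. J. Kollár, *Lectures on Resolution of
Singularities* (2007), Thm. 3.69 (order reduction for marked ideals) in dimension two, positive
characteristic `p > max-ord` — the end point of this group of files: the cosupport `F = cosupp(𝓘, b)`
of a tame marked ideal on `X` smooth of dimension `≤ 2` over a perfect field splits as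
`F = C ∪ (finite set of closed points)`, where `C` — the closure of the non-closed points of `F` —
is a regular curve along which `𝓘 = 𝓘_C^b` (locally `C` is the maximal-contact curve,
`KollarSurfaceOrderReductionTameLocal.stalkIdeal_eq_span_pow_of_specializes`); the blowing up of `C`
(3.111 Step 1) followed by the global sequence for the finitely many remaining points (3.104 Step
2.2 at each, glued: `KollarSurfaceOrderReductionTameGlobal.lean`,
`KollarSurfaceOrderReductionTameHypersurfacePart.lean`) resolves `(X, 𝓘, ∅, b)`.

* `exists_specializes_ne_of_mem_closure_setOf_not_isClosed`, `finite_diff_closure_setOf_not_isClosed`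
  — topology of a closed set `F` in a Noetherian sober space: a closed point of
  `C = closure {η ∈ F non-closed}` has a proper generization in `F`; `F ∖ C` is finite;
* `Kollar2007.exists_nhd_curvePart` — at a closed point `x ∈ C`: on a neighbourhood, the ideal
  `𝓘_C` of `C` is the (radical, regular) maximal-contact ideal and `𝓘 = 𝓘_C^b` stalkwise;
* `Kollar2007.curvePart_generator`, `Kollar2007.stalkIdeal_eq_pow_curvePart` — hence at EVERY point
  of `C` (closed points are dense, `X` being Jacobson);
* **`Kollar2007.exists_isResolutionOf_of_topologicalKrullDim_le_two`** — ORDER REDUCTION ON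
  SURFACES IN THE TAME REGIME: `X` smooth over a perfect field `k` of characteristic `p` (`p = 0`
  allowed), Noetherian, `dim X ≤ 2`, `max-ord 𝓘 ≤ b`, `1 ≤ b < p` ⟹ a smooth blow-up sequence on
  `X` RESOLVING `(X, 𝓘, ∅, b)` (BGMW Def. 3.1.3: regular centres in the successive cosupports,
  simple normal crossings with the exceptional boundary, empty final cosupport).

## Sources

* J. Kollár, *Lectures on Resolution of Singularities* (2007): Thm. 3.69, 3.70, 3.104 Step 2.2,
  3.105, 3.111 Step 1. [Kollar2007]
* E. Bierstone, D. Grigoriev, P. Milman, J. Włodarczyk, arXiv:1206.3090: Def. 3.1.3, Thm. 8.0.4.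
  [BierstoneGrigorievMilmanWlodarczyk2011]
* The Stacks Project, Tag 0052 (Noetherian sober spaces), Tag 01J7. [StacksProject]
-/

noncomputable section

open CategoryTheory CategoryTheory.Limits AlgebraicGeometry TopologicalSpace IsLocalRing
  Scheme.IdealSheafData

namespace Literature.AlgebraicGeometry.Resolution

universe u

/-! ## Topology: the closure of the non-closed points of a closed set -/

section Topology

variable {α : Type*} [TopologicalSpace α] [NoetherianSpace α] [QuasiSober α] {F : Set α}

/-- **A closed point of `C = closure {η ∈ F | η not closed}` has a proper generization in `F`**
(`F` closed in a Noetherian sober space). [cite: StacksProject, Tag 0052] -/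
theorem exists_specializes_ne_of_mem_closure_setOf_not_isClosed (hF : IsClosed F) {x : α}
    (hx : x ∈ closure {η | η ∈ F ∧ ¬ IsClosed ({η} : Set α)}) (hxcl : IsClosed ({x} : Set α)) :
    ∃ η ∈ F, η ⤳ x ∧ η ≠ x := by
  obtain ⟨ξ, hξx, hξ⟩ := exists_specializes_mem_closure_inter _ hx
  have hξne : ξ ≠ x := by
    rintro rfl
    rw [hxcl.closure_eq] at hξ
    have : ({η | η ∈ F ∧ ¬ IsClosed ({η} : Set α)} ∩ {ξ} : Set α) = ∅ :=
      Set.eq_empty_iff_forall_notMem.mpr fun y ⟨hy, hyx⟩ => hy.2 (by rw [Set.mem_singleton_iff.mp hyx]; exact hxcl)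
    rw [this, closure_empty] at hξ
    exact hξ
  refine ⟨ξ, ?_, hξx, hξne⟩
  exact hF.closure_subset_iff.mpr (fun y hy => hy.1)
    ((closure_mono Set.inter_subset_left) hξ)

/-- **`F ∖ C` is finite**: a point `x ∈ F` off `C` is closed and `{x}` is (the image of) an
irreducible component of `F` — whose generic point, if different from `x`, would be a non-closed
point of `F` specializing to `x`. [cite: StacksProject, Tag 0052] -/
theorem finite_diff_closure_setOf_not_isClosed (hF : IsClosed F) :
    (F \ closure {η | η ∈ F ∧ ¬ IsClosed ({η} : Set α)}).Finite := by
  have hfinI : (irreducibleComponents F).Finite := NoetherianSpace.finite_irreducibleComponents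
  have hsub : F \ closure {η | η ∈ F ∧ ¬ IsClosed ({η} : Set α)} ⊆
      ⋃ Z ∈ irreducibleComponents F, {x | ((↑) : F → α) '' Z = {x}} := by
    rintro x ⟨hxF, hxC⟩
    have hxcl : IsClosed ({x} : Set α) := by
      by_contra h
      exact hxC (subset_closure ⟨hxF, h⟩)
    let x' : F := ⟨x, hxF⟩
    refine Set.mem_iUnion₂.mpr
      ⟨irreducibleComponent x', irreducibleComponent_mem_irreducibleComponents x', ?_⟩
    -- the image in `α` is closed irreducible; its generic point must be `x`
    have hZirr : IsIrreducible (((↑) : F → α) '' irreducibleComponent x') :=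
      isIrreducible_irreducibleComponent.image _ continuous_subtype_val.continuousOn
    have hZcl : IsClosed (((↑) : F → α) '' irreducibleComponent x') :=
      hF.isClosedEmbedding_subtypeVal.isClosedMap _ isClosed_irreducibleComponent
    have hxZ : x ∈ ((↑) : F → α) '' irreducibleComponent x' := ⟨x', mem_irreducibleComponent, rfl⟩
    have hZF : ((↑) : F → α) '' irreducibleComponent x' ⊆ F := by
      rintro _ ⟨y, -, rfl⟩; exact y.2
    obtain ⟨ζ, hζ⟩ := QuasiSober.sober hZirr hZcl
    by_cases hζx : ζ = x
    · subst hζx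
      show _ = _
      rw [← hζ.def, hxcl.closure_eq]
    · exfalso
      have hspec : ζ ⤳ x := hζ.specializes hxZ
      have hζncl : ¬ IsClosed ({ζ} : Set α) := fun h => hζx (by
        have := specializes_iff_mem_closure.mp hspec
        rw [h.closure_eq] at this
        exact (Set.mem_singleton_iff.mp this).symm)
      have hζN : ζ ∈ {η | η ∈ F ∧ ¬ IsClosed ({η} : Set α)} := ⟨hZF hζ.mem, hζncl⟩
      exact hxC (closure_mono (Set.singleton_subset_iff.mpr hζN) hspec.mem_closure)
  refine Set.Finite.subset (hfinI.biUnion fun Z _ => Set.Subsingleton.finite ?_) hsub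
  intro a ha a' ha'
  have : ({a} : Set α) = {a'} := ha.symm.trans ha'
  exact Set.singleton_eq_singleton_iff.mp this

end Topology

/-! ## The curve part of a tame cosupport on a surface -/

namespace Kollar2007

variable (k : Type u) [Field k] (X : Scheme.{u}) [X.Over (Spec (.of k))]

/-- **At every point of `C` = closure of the non-closed points of `cosupp(𝓘, b)`: the ideal
`𝓘_C` of `C` has an order-one stalk generator and `𝓘 = 𝓘_C^b` stalkwise** (`X` smooth of
dimension `≤ 2` over a perfect field `k` of characteristic `p`, Noetherian, `max-ord 𝓘 ≤ b`,
`1 ≤ b`, `p = 0 ∨ b < p`). At a closed point `x ∈ C` a non-closed point of the cosupport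
specializes to `x`, so `𝓘_x = H_x^b` for the maximal-contact ideal `H` at `x`
(`stalkIdeal_eq_span_pow_of_specializes`) and `𝓘 = H^b` nearby; there `V(H)` is the cosupport,
hence (off the finitely many points of `cosupp ∖ C`) equal to `C`, so `𝓘_C = H` locally (both
radical); every point of `C` specializes to a closed point of `C` (`X` is Jacobson).
[cite: Kollar2007, 3.111 Step 1, Thm. 3.80] -/
theorem curvePart_pointwise (p : ℕ) [CharP k p] [PerfectField k] [Smooth (X ↘ Spec (.of k))]
    [NoetherianSpace X] (hX : topologicalKrullDim X ≤ 2) (I : X.IdealSheafData) {b : ℕ}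
    (hb : 1 ≤ b) (hbp : p = 0 ∨ b < p) (hmax : ∀ x : X, idealOrder I x ≤ b) (y : X)
    (hy : y ∈ closure {η | η ∈ (⟨I, [], b⟩ : MarkedIdeal X).support ∧ ¬ IsClosed ({η} : Set X)}) :
    (∃ v : X.presheaf.stalk y,
        stalkIdeal (vanishingIdeal ⟨closure {η | η ∈ (⟨I, [], b⟩ : MarkedIdeal X).support ∧
          ¬ IsClosed ({η} : Set X)}, isClosed_closure⟩) y = Ideal.span {v} ∧
          v ∉ (maximalIdeal (X.presheaf.stalk y)) ^ 2) ∧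
      stalkIdeal I y = stalkIdeal (vanishingIdeal ⟨closure {η | η ∈ (⟨I, [], b⟩ : MarkedIdeal X).support ∧
          ¬ IsClosed ({η} : Set X)}, isClosed_closure⟩) y ^ b := by
  classical
  haveI : IsLocallyNoetherian X := isLocallyNoetherian_of_locallyOfFiniteType_over k X
  haveI : JacobsonSpace X := LocallyOfFiniteType.jacobsonSpace (X ↘ Spec (.of k))
  have hXreg : Scheme.IsRegular X := Scheme.isRegular_of_smooth_over_field k X
  set M : MarkedIdeal X := ⟨I, [], b⟩ with hM
  set N : Set X := {η | η ∈ M.support ∧ ¬ IsClosed ({η} : Set X)} with hN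
  set P : X.IdealSheafData := vanishingIdeal ⟨closure N, isClosed_closure⟩ with hPdef
  have hF : IsClosed M.support :=
    MarkedIdeal.isClosed_support (hasFinitePresentationDifferentials_overHom k X)
      (hasLocalCoordinates_overHom k X) _
      (fun z j hj hjb => isUnit_natCast_stalk_of_char k X p (hbp.imp id le_of_lt) z j hj hjb)
  have hCF : closure N ⊆ M.support := hF.closure_subset_iff.mpr fun z hz => hz.1
  -- a closed point `x ∈ C` with `y ⤳ x`
  obtain ⟨x, hxy, hxcl⟩ := nonempty_inter_closedPoints (Z := closure ({y} : Set X))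
    ⟨y, subset_closure rfl⟩ isClosed_closure.isLocallyClosed
  have hyx : y ⤳ x := specializes_iff_mem_closure.mpr hxy
  have hxcl' : IsClosed ({x} : Set X) := hxcl
  have hxC : x ∈ closure N := (isClosed_closure.closure_subset_iff.mpr (Set.singleton_subset_iff.mpr hy)) hxy
  -- a proper generization `η ∈ cosupp` of `x`
  obtain ⟨η, hηF, hηx, hηne⟩ := exists_specializes_ne_of_mem_closure_setOf_not_isClosed hF hxC hxcl'
  -- maximal contact at `x`
  obtain ⟨U, hxU, H, -, hH, hsub, -⟩ := exists_isMaxContact_nhd_of_char k X p I hb hbp hmax x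
  haveI : Smooth ((U : Scheme.{u}) ↘ Spec (.of k)) :=
    inferInstanceAs (Smooth (U.ι ≫ X ↘ Spec (.of k)))
  haveI : IsLocallyNoetherian (U : Scheme.{u}) := isLocallyNoetherian_of_locallyOfFiniteType_over k _
  have hUreg : Scheme.IsRegular (U : Scheme.{u}) := Scheme.isRegular_of_smooth_over_field k _
  have hHreg : Scheme.IsRegular H.subscheme := isRegular_subscheme_of_generator _ hUreg hH
  let xU : (U : Scheme.{u}) := ⟨x, hxU⟩
  have hηU : η ∈ U := hηx.mem_open U.2 hxU
  let ηU : (U : Scheme.{u}) := ⟨η, hηU⟩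
  have hsuppU : (⟨I.comap U.ι, [], b⟩ : MarkedIdeal (U : Scheme.{u})).support = U.ι ⁻¹' M.support :=
    MarkedIdeal.support_comap_of_isOpenImmersion U.ι M
  have hηsupp : ηU ∈ (⟨I.comap U.ι, [], b⟩ : MarkedIdeal (U : Scheme.{u})).support := by
    rw [hsuppU]; exact hηF
  have hxF : x ∈ M.support := hCF hxC
  have hxsupp : xU ∈ (⟨I.comap U.ι, [], b⟩ : MarkedIdeal (U : Scheme.{u})).support := by
    rw [hsuppU]; exact hxF
  haveI := hUreg xU
  obtain ⟨v, hv, hv2⟩ := hH xU (hsub hxsupp)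
  have hIx : stalkIdeal (I.comap U.ι) xU = stalkIdeal (H ^ b) xU := by
    rw [stalkIdeal_eq_span_pow_of_specializes (U : Scheme.{u}) (I.comap U.ι) H
      (by rw [ringKrullDim_stalk_opens]; exact (ringKrullDim_stalk_le_topologicalKrullDim X x).trans hX)
      ((U.ι.isOpenEmbedding.isInducing.specializes_iff (x := ηU) (y := xU)).mp hηx)
      (fun h => hηne (congrArg Subtype.val h)) (hsub hηsupp) hηsupp
      (by rw [idealOrder_comap_of_isOpenImmersion]; exact hmax x) hv hv2,
      stalkIdeal_pow, hv, Ideal.span_singleton_pow]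
  obtain ⟨W₀, hxW₀, hW₀⟩ := exists_nhd_forall_stalkIdeal_eq (X := (U : Scheme.{u})) hIx
  -- shrink: remove the finitely many points of `cosupp ∖ C`
  have hSfin : (M.support \ closure N).Finite := finite_diff_closure_setOf_not_isClosed hF
  have hScl : IsClosed (M.support \ closure N) := by
    rw [← Set.biUnion_of_singleton (M.support \ closure N)]
    refine hSfin.isClosed_biUnion fun z hz => ?_
    by_contra h
    exact hz.2 (subset_closure ⟨hz.1, h⟩)
  let S' : X.Opens := ⟨(M.support \ closure N)ᶜ, hScl.isOpen_compl⟩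
  let W₁ : (U : Scheme.{u}).Opens := W₀ ⊓ U.ι ⁻¹ᵁ S'
  have hxW₁ : xU ∈ W₁ := ⟨hxW₀, fun h => h.2 hxC⟩
  let g : (W₁ : Scheme.{u}) ⟶ X := W₁.ι ≫ U.ι
  haveI : IsOpenImmersion g := inferInstance
  haveI : IsLocallyNoetherian (W₁ : Scheme.{u}) := LocallyOfFiniteType.isLocallyNoetherian g
  -- `P|_{W₁} = H|_{W₁}`
  have hPg : P.comap g = H.comap W₁.ι := by
    refine eq_of_radical_of_support_eq ?_ ?_ ?_
    · rw [hPdef, comap_vanishingIdeal_of_isOpenImmersion]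
      exact radical_vanishingIdeal _
    · haveI : IsReduced (H.comap W₁.ι).subscheme :=
        (Scheme.IsRegular.subscheme_comap_of_isOpenImmersion W₁.ι hHreg).isReduced
      exact radical_eq_of_isReduced_subscheme _
    · ext w
      rw [support_comap, support_comap]
      change g w ∈ (P.support : Set X) ↔ W₁.ι w ∈ (H.support : Set U)
      rw [hPdef, coe_support_vanishingIdeal]
      change g w ∈ closure N ↔ _
      constructor
      · intro hw
        apply hsub
        rw [MarkedIdeal.support_comap_of_isOpenImmersion]
        exact hCF hw
      · intro hw
        have h1 : (w.1 : (U : Scheme.{u})) ∈ (⟨I.comap U.ι, [], b⟩ : MarkedIdeal (U : Scheme.{u})).support := by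
          rw [MarkedIdeal.mem_support_iff]
          change stalkIdeal (I.comap U.ι) w.1 ≤ _
          rw [hW₀ _ w.2.1, stalkIdeal_pow]
          exact Ideal.pow_right_mono ((mem_support_iff_stalkIdeal_le H _).mp hw) b
        rw [hsuppU] at h1
        by_contra hC
        exact w.2.2 ⟨h1, hC⟩
  -- `y` lies in the range of `g`
  have hyg : y ∈ Set.range g := by
    have hxg : x ∈ Set.range g := ⟨⟨xU, hxW₁⟩, rfl⟩
    exact hyx.mem_open g.isOpenEmbedding.isOpen_range hxg
  obtain ⟨w, rfl⟩ := hyg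
  haveI : IsIso (g.stalkMap w) := (IsOpenImmersion.iff_isIso_stalkMap.mp inferInstance).2 w
  haveI : IsIso ((W₁ : (U : Scheme.{u}).Opens).ι.stalkMap w) :=
    (IsOpenImmersion.iff_isIso_stalkMap.mp inferInstance).2 w
  have hwH : W₁.ι w ∈ H.support := by
    have : w ∈ (H.comap W₁.ι).support := by
      rw [← hPg, support_comap]
      change g w ∈ (P.support : Set X)
      rw [hPdef, coe_support_vanishingIdeal]
      exact hy
    rw [support_comap] at this
    exact this
  refine ⟨?_, ?_⟩
  · -- order-one generator, transported from `H`
    obtain ⟨v₁, hv₁, hv₁2⟩ := exists_generator_notMem_sq_comap_of_isLocalIso W₁.ι hH w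
      (by rw [support_comap]; exact hwH)
    refine ⟨(stalkEquivOfIsLocalIso g w).symm v₁, ?_, ?_⟩
    · rw [stalkIdeal_eq_map_symm_of_isLocalIso g P w, hPg, hv₁, Ideal.map_span, Set.image_singleton]
    · exact (notMem_sq_maximalIdeal_iff_of_ringEquiv (stalkEquivOfIsLocalIso g w).symm v₁).mp hv₁2
  · -- `𝓘 = P^b` at `g w`
    rw [← stalkIdeal_pow, ← stalkIdeal_comap_eq_iff_of_isIso_stalkMap g I (P ^ b) w, comap_pow, hPg,
      ← comap_pow, show I.comap g = (I.comap U.ι).comap W₁.ι from comap_comp I W₁.ι U.ι,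
      stalkIdeal_comap_eq_iff_of_isIso_stalkMap W₁.ι (I.comap U.ι) (H ^ b) w]
    exact hW₀ _ w.2.1

/-- **Order reduction for marked ideals on surfaces in the tame regime — the global theorem.**
Let `X` be smooth over a perfect field `k` of characteristic `p` (`p = 0` allowed), Noetherian, of
dimension `≤ 2`, and `𝓘` an ideal sheaf with `max-ord 𝓘 ≤ b`, `1 ≤ b`, `p = 0 ∨ b < p`. Then there
is a smooth blow-up sequence on `X` RESOLVING the marked ideal `(X, 𝓘, ∅, b)` in the sense of
BGMW Def. 3.1.3 (`CentreSeq.IsResolutionOf`): first the blowing up of the curve part `C` of the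
cosupport (a regular curve with `𝓘 = 𝓘_C^b` along it, Kollár 3.111 Step 1), then the glued local
order reductions at the finitely many remaining points (3.104 Step 2.2: maximal-contact curve,
order reduction in dimension one, going up; 3.105). Kollár's Thm. 3.69 in dimension two for
`p > max-ord`, with the centres of the characteristic-zero algorithm.
[cite: Kollar2007, Thm. 3.69, 3.70, 3.104 Step 2.2, 3.105, 3.111 Step 1]
[cite: BierstoneGrigorievMilmanWlodarczyk2011, Def. 3.1.3, Thm. 8.0.4] -/
theorem exists_isResolutionOf_of_topologicalKrullDim_le_two (p : ℕ) [CharP k p] [PerfectField k]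
    [Smooth (X ↘ Spec (.of k))] [NoetherianSpace X] (hX : topologicalKrullDim X ≤ 2)
    (I : X.IdealSheafData) {b : ℕ} (hb : 1 ≤ b) (hbp : p = 0 ∨ b < p)
    (hmax : ∀ x : X, idealOrder I x ≤ b) :
    ∃ s : CentreSeq X, s.IsResolutionOf ⟨I, [], b⟩ := by
  haveI : IsLocallyNoetherian X := isLocallyNoetherian_of_locallyOfFiniteType_over k X
  have hF : IsClosed (⟨I, [], b⟩ : MarkedIdeal X).support :=
    MarkedIdeal.isClosed_support (hasFinitePresentationDifferentials_overHom k X)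
      (hasLocalCoordinates_overHom k X) _
      (fun z j hj hjb => isUnit_natCast_stalk_of_char k X p (hbp.imp id le_of_lt) z j hj hjb)
  set N : Set X := {η | η ∈ (⟨I, [], b⟩ : MarkedIdeal X).support ∧ ¬ IsClosed ({η} : Set X)} with hN
  set P : X.IdealSheafData := vanishingIdeal ⟨closure N, isClosed_closure⟩ with hPdef
  have hPsupp : (P.support : Set X) = closure N := by rw [hPdef, coe_support_vanishingIdeal]; rfl
  refine exists_isResolutionOf_of_hypersurface_part k X p I hb hbp hmax P ?_ ?_ ?_ ?_ ?_
  · intro y hy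
    exact (curvePart_pointwise k X p hX I hb hbp hmax y (by rw [← hPsupp]; exact hy)).1
  · intro y hy
    exact (curvePart_pointwise k X p hX I hb hbp hmax y (by rw [← hPsupp]; exact hy)).2
  · rw [hPsupp]
    exact finite_diff_closure_setOf_not_isClosed hF
  · intro y hy
    rw [hPsupp] at hy
    by_contra h
    exact hy.2 (subset_closure ⟨hy.1, h⟩)
  · exact fun y _ => (ringKrullDim_stalk_le_topologicalKrullDim X y).trans hX

end Kollar2007

end Literature.AlgebraicGeometry.Resolution

end
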